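import Literature.NumberTheory.EllipticCurves.JetchevSkinnerWan2017.AnticyclotomicControlMultiplicative
import Summits.BirchSwinnertonDyer.BirchSwinnertonDyer.Theorems.ErratumRoadFiveOpenInputIMCOneSided
import Summits.BirchSwinnertonDyer.Rank1Residual.X11b.BDPRouteOpenInputFromLever
import Summits.BirchSwinnertonDyer.Rank1Residual.Partition.IrreducibleOverQuadraticField
import HarnessLib

/-!
# Route `ErratumRoadFive`, crux `OpenInputIMC` (item stmt-BirchSwinnertonDyer-19061, child 19274
# `OpenInputRamOffErratumLocus`): the control identity `P2ControlOnTreeAt W p` for EVERY curve —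
# no semistability, no Locus — by citation of Jetchev–Skinner–Wan 2017 Thm. 3.3.1 at a multiplicative `p`

Cell `bsd-stepL` (run/shared/lean/pub/bsd-stepL/), seat `bsd-stepL-imc-t1` (literature typer, session
g5), companion of the Literature fact `JetchevSkinnerWan2017.thm331_anticyclotomicControl_mult`
(p428223, `Literature/NumberTheory/EllipticCurves/JetchevSkinnerWan2017/AnticyclotomicControlMultiplicative.lean`),
answering the TYPER ASK of seat `bsd-stepL-imc-p1` (HOME/STATUS.md 2026-08-26T05:34:26Z): in the
reduction `… → thm23_anticyclotomicControl → REST″ → OpenInputRamOffErratumLocus` the published control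
theorem entered as `Castella2018.thm23_anticyclotomicControl`, whose binder `Semistable W` (Castella's
§2.1 standing hypothesis) kept the off-Locus NON-semistable sub-atom (`p ∣ ∏c ∧ ¬Semistable`; 34 474
class-wide pairs at `p ≥ 5`) inside REST″.

HONEST FRAMING (verbatim for the cell): BSD is NOT proved by any of this; a closed item closes a rung
leaf («closes rung K2 of BirchSwinnertonDyer»), never summit credit; X11b stays CONSTRUCTION-SHAPED;
THE open input (IMC≥∘BDP) is untouched. THEOREMS ONLY (no definition, no named fact, no `sorry`);
every theorem is CONDITIONAL on the published named facts it lists.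

## What this file proves

* §1 `controlOnTreeAt_of_thm331Mult[_embAt]` — the cell's shape `X11b.ControlOnTreeAt p κ v γ ι P`
  (multiplicative `p`) FROM the JSW fact at ANY globally minimal `W` with `Mult W p`, `p ≥ 3`, `K`
  imaginary quadratic with `p` split and `E[p]` irreducible over `G_K`, `rank_ℤ E(K) = 1`,
  `#Ш(E/K)[p^∞] < ∞`, `P` of infinite order — the analogue of `RouteR1ControlCastella`'s
  `controlOnTreeAt_of_thm23[_embAt]` with (`hsst`, `hirr`, `5 ≤ p`) replaced by (`hirrK`, `3 ≤ p`);
  same three currency bridges (`AcSelmer.hasCharValuationAt_iff_literature`,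
  `tamagawaProductSplit_eq_literature`, `padicLogOrd_eq_literature`).
* §2 **`p2ControlOnTreeAt_of_thm331Mult`** — `P2ControlOnTreeAt W p` at EVERY pair `(W, p)` from the
  JSW fact + Kolyvagin (`kolyvagin`: `rank_ℤ E(K) = 1`, `#Ш(E/K) < ∞` at a non-torsion Heegner point):
  at a p2 datum the pair is in X11b (so `Mult W p`), `p ≥ 5`, `ρ̄_{E,p}` is ONTO — whence (irred_𝒦) at
  the (quadratic) Heegner field by the GLUE seat's theorem `irrK_of_surj` —, and `p ∣ N` splits in `K`
  (`SatisfiesHeegnerHypothesis.of_dvd`). Compare `p2ControlOnTreeAt_of_thm23_of_semistable`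
  (semistable pairs) and `p2ControlOnTreeAt_of_locus` (Locus `p ∤ ∏c`): their union left exactly the
  non-semistable off-Locus pairs; this theorem has NO side condition on `W`.
* §3 `p2ControlOnTreeAt_forall_of_thm331Mult` (the ∀-form) and
  `openInputOnTreeAt_of_missingLowerBoundAt_of_ram_of_thm331Mult` — imc-p1's one-sided tightness
  `openInputOnTreeAt_of_missingLowerBoundAt_of_ram` (p422211) with its control hypothesis `hC`
  DISCHARGED by §2: on the (ram) atom, the lower half `Typed.MissingLowerBoundAt W p` ALONE gives
  `P2OpenInputOnTreeAt W p`, for any conductor and any Tamagawa numbers.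
* §4 `p2ControlOnTree_odd_of_thm331Mult` — every ODD `p` (`p = 3` included): the control hypothesis
  `hC` of team x11b3's `Three/OpenInputTight` at EVERY X11b pair (compare `p2ControlOnTree_odd_of_locus`,
  Locus only) — for the K2@3 routes' Tamagawa atom (T2′)@3.
* §5 `r1ControlOnTreeAt_of_thm331Mult` — route R1's currency `R1ControlOnTreeAt W p` (erratum fields,
  `q` ramified) from the fact + GZK, i.e. `r1ControlOnTreeAt_of_thm23` WITHOUT `hsst` ((irred_𝒦) from
  (irr) + the (ram) witness: `surj_of_irr_of_ram`, `irrK_of_surj`).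

References: [JetchevSkinnerWan2017] Thm. 3.3.1, Prop. 3.2.1, §3.3.3, §3.5 (3.5.c), §7.4.1;
[Castella2018] proof of Thm. 2.3 ((eq:calcul), (eq:tam-p)); [Kolyvagin1990] Thm. A; [Gross1991]
Thm. 1.3; HOME/STATUS.md 05:34:26Z (imc-p1), 06:13:12Z (imc-t1).
-/

set_option autoImplicit false
set_option linter.dupNamespace false

noncomputable section

open scoped Classical

open WeierstrassCurve NumberField IsDedekindDomain Field
open Literature.NumberTheory.EllipticCurves Literature.NumberTheory.EllipticCurves.ModularForms
  Literature.NumberTheory.EllipticCurves.Rank1Residual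
  Literature.NumberTheory.EllipticCurves.Rank1Residual.Typed
  Literature.NumberTheory.EllipticCurves.Castella2018
  Literature.NumberTheory.EllipticCurves.JetchevSkinnerWan2017
open Summit.BirchSwinnertonDyer.Rank1Residual Summit.BirchSwinnertonDyer.Rank1Residual.X11b
  Summit.BirchSwinnertonDyer.Rank1Residual.X11b.AcSelmer

namespace Summit.BirchSwinnertonDyer.BirchSwinnertonDyer.Theorems

/-! ### §1 The cell's control shape FED by the JSW fact at a multiplicative `p`, any conductor -/

section Control

variable {W : WeierstrassCurve ℚ} [W.IsElliptic] [W.IsGloballyMinimal] {p : ℕ} [Fact p.Prime]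
  {K : Type} [Field K] [NumberField K]

/-- **`X11b.ControlOnTreeAt` (multiplicative `p`) FROM Jetchev–Skinner–Wan Thm. 3.3.1 + (3.5.c), ANY
conductor.** At every datum of the fact — `W/ℚ` globally minimal (NOT assumed semistable), `p ≥ 3` of
multiplicative reduction, `K` imaginary quadratic with `p` split, `E[p]` irreducible over `G_K`,
`ι : K ↪ ℚ_p` inducing the STRICT prime `v`, `κ` anticyclotomic with generator `γ`, `rank_ℤ E(K) = 1`,
`#Ш(E/K)[p^∞] < ∞`, `P` of infinite order — the typed link `ControlOnTreeAt p κ v γ ι P` HOLDS.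
[cite: JetchevSkinnerWan2017, Thm. 3.3.1 (arXiv:1512.06894 Thm. 8, p. 11) with §3.5 (3.5.c) (p. 15)]
[cite: Castella2018, proof of Thm. 2.3, (eq:calcul)–(eq:tam-p) (arXiv:1704.06608 p. 6)] -/
theorem controlOnTreeAt_of_thm331Mult (h : thm331_anticyclotomicControl_mult)
    (hp : 3 ≤ p) (hmult : Mult W p) (hK : IsImaginaryQuadratic K)
    (hHp : SatisfiesHeegnerHypothesis p K)
    (hirrK : (W.baseChange K).HasIrreducibleModPGaloisRep p)
    (ι : K →+* ℚ_[p]) (v : HeightOneSpectrum (𝓞 K))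
    (hv : ∀ x : 𝓞 K, x ∈ v.asIdeal ↔ ‖ι (x : K)‖ < 1)
    (κ : ZpExtension K p) (hκ : κ.IsAnticyclotomic)
    (γ : Field.absoluteGaloisGroup K) [Fact (κ.IsTopGenerator γ)]
    (hrk : (W.baseChange K).mordellWeilRank = 1)
    (hfin : Finite (AddCommGroup.primaryComponent (W.baseChange K).sha p))
    (P : (W.baseChange K).toAffine.Point) (hP : ¬ IsOfFinAddOrder P) :
    ControlOnTreeAt p κ v γ ι P := by
  obtain ⟨n, hn, hval⟩ :=
    hasCharValuationAt_of_thm331_mult h hp hmult K hK hHp hirrK ι v hv κ hκ γ hrk hfin P hP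
  refine ⟨n, (AcSelmer.hasCharValuationAt_iff_literature _ p κ v ∅ γ n).mpr hn, ?_⟩
  rw [tamagawaProductSplit_eq_literature, padicLogOrd_eq_literature]
  exact hval

/-- **`ControlOnTreeAt p κ 𝔭 γ (embAt K p 𝔭) P` FROM the JSW fact** at a degree-one prime `𝔭 ∣ p` —
multr1's original currency (`embAt K p 𝔭` induces `𝔭`, `mem_asIdeal_iff_norm_embAt_lt_one`); any
conductor. [cite: JetchevSkinnerWan2017, Thm. 3.3.1 (arXiv:1512.06894 Thm. 8, p. 11) with §3.5 (3.5.c)] -/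
theorem controlOnTreeAt_of_thm331Mult_embAt (h : thm331_anticyclotomicControl_mult)
    (hp : 3 ≤ p) (hmult : Mult W p) (hK : IsImaginaryQuadratic K)
    (hHp : SatisfiesHeegnerHypothesis p K)
    (hirrK : (W.baseChange K).HasIrreducibleModPGaloisRep p)
    (κ : ZpExtension K p) (hκ : κ.IsAnticyclotomic)
    (γ : Field.absoluteGaloisGroup K) [Fact (κ.IsTopGenerator γ)]
    (𝔭 : HeightOneSpectrum (𝓞 K)) (h𝔭 : ((p : ℕ) : 𝓞 K) ∈ 𝔭.asIdeal)
    (he : 𝔭.asIdeal.ramificationIdx (𝓞 ℚ) = 1) (hf : 𝔭.asIdeal.inertiaDeg (𝓞 ℚ) = 1)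
    (hrk : (W.baseChange K).mordellWeilRank = 1)
    (hfin : Finite (AddCommGroup.primaryComponent (W.baseChange K).sha p))
    (P : (W.baseChange K).toAffine.Point) (hP : ¬ IsOfFinAddOrder P) :
    ControlOnTreeAt p κ 𝔭 γ (embAt K p 𝔭 h𝔭 he hf) P :=
  controlOnTreeAt_of_thm331Mult h hp hmult hK hHp hirrK (embAt K p 𝔭 h𝔭 he hf) 𝔭
    (mem_asIdeal_iff_norm_embAt_lt_one 𝔭 h𝔭 he hf) κ hκ γ hrk hfin P hP

end Control

/-! ### §2 Route p2's control identity at EVERY pair -/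

section P2

variable (W : WeierstrassCurve ℚ) [W.IsElliptic] [W.IsGloballyMinimal] (p : ℕ) [Fact p.Prime]

/-- **`P2ControlOnTreeAt W p` for EVERY `(W, p)` from Jetchev–Skinner–Wan Thm. 3.3.1 (multiplicative
`p`) + Kolyvagin.** At a p2 datum (X11b pair, so `p` multiplicative; `p ≥ 5`; `ρ̄_{E,p}` onto; an
odd-`d_K` Manin-good Heegner datum with non-torsion Heegner point `P`; anticyclotomic `κ`, `γ`,
degree-one `𝔭 ∋ p`, THE embedding `embAt`): `rank_ℤ E(K) = 1` and `#Ш(E/K) < ∞` by Kolyvagin (`hKo`),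
`p ∣ N` splits in `K` (`SatisfiesHeegnerHypothesis.of_dvd`), and (irred_𝒦) at the quadratic field `K`
from surjectivity (`irrK_of_surj`); the link `controlOnTreeAt_of_thm331Mult_embAt` feeds the shape.
NO semistability, NO Locus condition, ANY Tamagawa numbers. CONDITIONAL on the named facts; nothing
booked. [cite: JetchevSkinnerWan2017, Thm. 3.3.1 with §3.5 (3.5.c) (arXiv:1512.06894 pp. 11, 15), §7.4.1 (p. 30)]
[cite: Kolyvagin1990, Thm. A] [cite: Gross1991, Thm. 1.3] -/
theorem p2ControlOnTreeAt_of_thm331Mult (h : thm331_anticyclotomicControl_mult)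
    (hKo : ∀ (N : ℕ) [NeZero N] (W : WeierstrassCurve ℚ) (K : Type) [Field K] [NumberField K],
      kolyvagin N W K) :
    P2ControlOnTreeAt W p := by
  intro N _ K _ _ Dt H ι P hX hp5 hsurj hN hK _ _ _ hHN _ hP _ hPinf κ hκ γ _ 𝔭 h𝔭 he hf
  obtain ⟨-, -, hmult, -⟩ := hX
  obtain ⟨hrk, hfinK⟩ := hKo N W K hK hHN ⟨Dt, H, ι, hP⟩ hPinf
  haveI : Finite (W.baseChange K).sha := hfinK
  have hfin : Finite (AddCommGroup.primaryComponent (W.baseChange K).sha p) := inferInstance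
  have hpN : p ∣ N := hN ▸ dvd_conductorNorm_of_mult hmult
  have hHp : SatisfiesHeegnerHypothesis p K := SatisfiesHeegnerHypothesis.of_dvd hpN hHN
  have hirrK : (W.baseChange K).HasIrreducibleModPGaloisRep p := irrK_of_surj W p hsurj K hK.1
  exact controlOnTreeAt_of_thm331Mult_embAt h (le_trans (by norm_num) hp5) hmult hK hHp hirrK κ hκ γ
    𝔭 h𝔭 he hf hrk hfin P hPinf

end P2

/-! ### §3 One-sided tightness with the control hypothesis discharged -/

section OneSided

variable (W : WeierstrassCurve ℚ) [W.IsElliptic] [W.IsGloballyMinimal] (p : ℕ) [Fact p.Prime]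

/-- **`P2ControlOnTreeAt` at every pair, universally quantified** (the form consumed by class-level
glue). [cite: JetchevSkinnerWan2017, Thm. 3.3.1 with §3.5 (3.5.c) (arXiv:1512.06894 pp. 11, 15)] -/
theorem p2ControlOnTreeAt_forall_of_thm331Mult (h : thm331_anticyclotomicControl_mult)
    (hKo : ∀ (N : ℕ) [NeZero N] (W : WeierstrassCurve ℚ) (K : Type) [Field K] [NumberField K],
      kolyvagin N W K) :
    ∀ (W : WeierstrassCurve ℚ) [W.IsElliptic] [W.IsGloballyMinimal] (p : ℕ) [Fact p.Prime],
      P2ControlOnTreeAt W p :=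
  fun W _ _ p _ ↦ p2ControlOnTreeAt_of_thm331Mult W p h hKo

/-- **On the (ram) atom, the lower half ALONE gives THE open input — control by citation.** imc-p1's
one-sided tightness `openInputOnTreeAt_of_missingLowerBoundAt_of_ram` (p422211:
`Typed.MissingLowerBoundAt W p` + `P2ControlOnTreeAt W p` + `Ram W p` ⟹ `P2OpenInputOnTreeAt W p`)
with its control hypothesis `hC` DISCHARGED by `p2ControlOnTreeAt_of_thm331Mult` — for any conductor
and any Tamagawa numbers. CONDITIONAL on the named facts (`thm331_anticyclotomicControl_mult`,
Gross–Zagier, Kolyvagin, Skinner 2016 Thm. C, GZK, modularity); a TIGHTNESS statement, nothing claimed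
about the lower half; nothing booked. [cite: JetchevSkinnerWan2017, Thm. 3.3.1 with §3.5 (3.5.c) (arXiv:1512.06894 pp. 11, 15)]
[cite: Castella2018, Thm. 3.2 (arXiv:1704.06608 p. 9)] [cite: Skinner2016PacificMC, Thm. C (§1)]
[cite: Kolyvagin1990, Thm. A] -/
theorem openInputOnTreeAt_of_missingLowerBoundAt_of_ram_of_thm331Mult
    (h : thm331_anticyclotomicControl_mult)
    (hGZ : ∀ (N : ℕ) [NeZero N] (W : WeierstrassCurve ℚ) (K : Type) [Field K] [NumberField K],
      gross_zagier N W K)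
    (hKo : ∀ (N : ℕ) [NeZero N] (W : WeierstrassCurve ℚ) (K : Type) [Field K] [NumberField K],
      kolyvagin N W K)
    (hSk : Skinner2016.thmC_padicValRat_bsd_rank_zero)
    (hGZK : rank_eq_analyticRank_of_analyticRank_le_one) (hmod : hasEntireLFunction_rat)
    (hram : Ram W p) (hlow : Typed.MissingLowerBoundAt W p) : P2OpenInputOnTreeAt W p :=
  openInputOnTreeAt_of_missingLowerBoundAt_of_ram W p hGZ hKo hSk hGZK hmod
    (p2ControlOnTreeAt_of_thm331Mult W p h hKo) hram hlow

end OneSided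

/-! ### §4 Every ODD `p` (so `p = 3`): the control hypothesis `hC` of `Three/OpenInputTight` at every pair -/

section Odd

variable (W : WeierstrassCurve ℚ) [W.IsElliptic] [W.IsGloballyMinimal] (p : ℕ) [Fact p.Prime]

/-- **The odd-`p` control hypothesis of team x11b3's `Three/OpenInputTight` (`hC`: `ControlOnTreeAt` at
every p2-type datum of the pair, no `p ≥ 5`) holds at EVERY X11b pair — `p = 3` included — from the
JSW fact + Kolyvagin.** Same proof as `p2ControlOnTreeAt_of_thm331Mult` (`ClassX11b W p` gives `p ≠ 2`,
hence `3 ≤ p`, and `Mult W p`; (irred_𝒦) from `Surj W p` by `irrK_of_surj`). Compare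
`X11b.p2ControlOnTree_odd_of_locus` (Locus `p ∤ ∏c`, from the Poitou–Tate atoms): NO Locus condition
here, so the (T2′) Tamagawa atom at `p = 3` gets its control identity by citation as well. CONDITIONAL
on the named facts; nothing booked. [cite: JetchevSkinnerWan2017, Thm. 3.3.1 with §3.5 (3.5.c) (arXiv:1512.06894 pp. 11, 15; §2.1 "p ≥ 3")]
[cite: Kolyvagin1990, Thm. A] [cite: Gross1991, Thm. 1.3] -/
theorem p2ControlOnTree_odd_of_thm331Mult (h : thm331_anticyclotomicControl_mult)
    (hKo : ∀ (N : ℕ) [NeZero N] (W : WeierstrassCurve ℚ) (K : Type) [Field K] [NumberField K],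
      kolyvagin N W K) :
    ∀ (N : ℕ) [NeZero N] (K : Type) [Field K] [NumberField K]
      (Dt : ModularParametrizationData W N) (H : HeegnerDatum N (NumberField.discr K)) (ι : K →+* ℂ)
      (P : (W.baseChange K).toAffine.Point),
      ClassX11b W p → Surj W p → W.conductorNorm ℤ = N → IsImaginaryQuadratic K →
      Odd (NumberField.discr K) → ¬ (p : ℤ) ∣ NumberField.discr K → ¬ p ∣ Units.torsionOrder K →
      SatisfiesHeegnerHypothesis N K →
      (W.quadraticTwist (NumberField.discr K : ℚ)).entireLFunction 1 ≠ 0 →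
      WeierstrassCurve.Affine.Point.map ι.toRatAlgHom P = heegnerPointComplex Dt H →
      ¬ (p : ℤ) ∣ Dt.c → ¬ IsOfFinAddOrder P →
      ∀ (κ : ZpExtension K p), κ.IsAnticyclotomic →
        ∀ (γ : Field.absoluteGaloisGroup K) [Fact (κ.IsTopGenerator γ)]
          (𝔭 : HeightOneSpectrum (𝓞 K)) (h𝔭 : ((p : ℕ) : 𝓞 K) ∈ 𝔭.asIdeal)
          (he : 𝔭.asIdeal.ramificationIdx (𝓞 ℚ) = 1) (hf : 𝔭.asIdeal.inertiaDeg (𝓞 ℚ) = 1),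
          ControlOnTreeAt p κ 𝔭 γ (embAt K p 𝔭 h𝔭 he hf) P := by
  intro N _ K _ _ Dt H ι P hX hsurj hN hK _ _ _ hHN _ hP _ hPinf κ hκ γ _ 𝔭 h𝔭 he hf
  obtain ⟨-, hp2, hmult, -⟩ := hX
  have hp3 : 3 ≤ p := lt_of_le_of_ne (Fact.out : p.Prime).two_le (Ne.symm hp2)
  obtain ⟨hrk, hfinK⟩ := hKo N W K hK hHN ⟨Dt, H, ι, hP⟩ hPinf
  haveI : Finite (W.baseChange K).sha := hfinK
  have hfin : Finite (AddCommGroup.primaryComponent (W.baseChange K).sha p) := inferInstance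
  have hpN : p ∣ N := hN ▸ dvd_conductorNorm_of_mult hmult
  have hHp : SatisfiesHeegnerHypothesis p K := SatisfiesHeegnerHypothesis.of_dvd hpN hHN
  have hirrK : (W.baseChange K).HasIrreducibleModPGaloisRep p := irrK_of_surj W p hsurj K hK.1
  exact controlOnTreeAt_of_thm331Mult_embAt h hp3 hmult hK hHp hirrK κ hκ γ 𝔭 h𝔭 he hf hrk hfin P
    hPinf

end Odd

/-! ### §5 Route R1's currency: `R1ControlOnTreeAt W p` at every pair of its population, no semistability -/

section RouteR1

variable (W : WeierstrassCurve ℚ) [W.IsElliptic] [W.IsGloballyMinimal] (p : ℕ) [Fact p.Prime]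

/-- **`R1ControlOnTreeAt W p` from the JSW fact and GZK — NO `Semistable W`.** At every datum of route
R1's input (A′-hypotheses `5 ≤ p`, `mult(p)`, `irr(p)`; `r_an = 1`; a non-split multiplicative `q ≠ p` at
which `E[p]` is ramified; an erratum field `K` for `q`, in which `p` splits and `L(E^{d_K},1) ≠ 0`; a
Manin-good Heegner datum and its point `P` of infinite order; any anticyclotomic `κ`, generator `γ`,
degree-one `𝔭 ∋ p`): `ControlOnTreeAt p κ 𝔭 γ (embAt K p 𝔭) P` by `controlOnTreeAt_of_thm331Mult_embAt`,
with `rank_ℤ E(K) = 1`, `#Ш(E/K)[p^∞] < ∞` from GZK for `E` and `E^{d_K}` (`hGZK`;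
`mordellWeilRank_baseChange_eq_one_and_finite_sha_of_twist_L_one_ne_zero`) and (irred_𝒦) from
(irr) + the (ram) witness `q` (`surj_of_irr_of_ram`, then `irrK_of_surj`). This is
`RouteR1ControlCastella`'s `r1ControlOnTreeAt_of_thm23` with the binder `hsst : Semistable W` REMOVED.
CONDITIONAL on the named facts; nothing booked.
[cite: JetchevSkinnerWan2017, Thm. 3.3.1 with §3.5 (3.5.c) (arXiv:1512.06894 pp. 11, 15), §7.4.1 (p. 30)]
[cite: Castella2018, §5 (arXiv:1704.06608 p. 12)] [cite: GrossLMS1991, Thm. 1.3] -/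
theorem r1ControlOnTreeAt_of_thm331Mult (h : thm331_anticyclotomicControl_mult)
    (hGZK : rank_eq_analyticRank_of_analyticRank_le_one) : R1ControlOnTreeAt W p := by
  intro _ q _ K _ _ Dt H ι P hE hr hqp hmq hns hvq hK hCas hP hc hinf κ hκ γ _ 𝔭 h𝔭 he hf
  have hKiq : IsImaginaryQuadratic K := hK.1
  have hsp : SplitsIn K p := hK.splitsIn_of_mult hE.2.1 (Ne.symm hqp)
  have hHp : SatisfiesHeegnerHypothesis p K := satisfiesHeegnerHypothesis_of_splitsIn Fact.out hsp
  obtain ⟨hrQ, hShaQ⟩ := hGZK W hr.le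
  rw [hr] at hrQ
  obtain ⟨hrk, hfin⟩ :=
    mordellWeilRank_baseChange_eq_one_and_finite_sha_of_twist_L_one_ne_zero hGZK W K hKiq p hrQ hShaQ
      hK.2.2.2.2
  have hram : Ram W p := ⟨q, inferInstance, hqp, hmq, hvq⟩
  have hirrK : (W.baseChange K).HasIrreducibleModPGaloisRep p :=
    irrK_of_surj W p (surj_of_irr_of_ram W p hE.2.2.1 hram) K hKiq.1
  exact controlOnTreeAt_of_thm331Mult_embAt h (le_trans (by norm_num) hE.1) hE.2.1 hKiq hHp hirrK κ hκ γ
    𝔭 h𝔭 he hf hrk hfin P hinf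

end RouteR1

end Summit.BirchSwinnertonDyer.BirchSwinnertonDyer.Theorems

end
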